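import Mathlib.Algebra.Quaternion
import Mathlib.Algebra.Algebra.Operations
import Mathlib.NumberTheory.Padics.PadicNumbers
import Mathlib.NumberTheory.NumberField.Basic
import Mathlib.GroupTheory.Index
import Mathlib.GroupTheory.Finiteness
import Mathlib.RingTheory.Finiteness.Basic
import Mathlib.Algebra.Module.Rat
import Mathlib.LinearAlgebra.FreeModule.PID
import Mathlib.LinearAlgebra.FreeModule.Finite.Quotient
import Mathlib.RingTheory.Valuation.Basic
import Mathlib.RingTheory.MvPolynomial.Basic
import Mathlib.Data.Matrix.Basic
import HarnessLib

/-!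
# Definite Brandt set-up, right ideals, Hecke neighbours and Gross points — ADELIC-FREE package

Topic `Literature/NumberTheory/Automorphic`, definition request `defn-Brandt.DefiniteSetupLite`
(route repair of `BirchSwinnertonDyer/VerticalContact` rev 1 and `ToricShedding` rev 3). This
module imports MATHLIB ONLY (nothing from `Literature.NumberTheory.Automorphic`: in particular not
`BrandtXi`, `JordanZassenhaus`, `QuaternionAlgebraAdelic`, `BrandtModule*`, whose module cone
carries unproved named facts), so that route statements can be phrased over it without importing
that cone. Every definition below is the VERBATIM `let`-clause inlined today in the route items
`VerticalContact` / `VerticalSelmerBound` (Theses/VerticalContact.lean) and `ToricPeriodShedding` /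
`BipartiteToricBound` (Theses/ToricShedding.lean), packaged under a name, with an unfolding lemma
(`Iff.rfl` / `rfl`) back to the inline clause:

* `Brandt.IsRamifiedExactlyAtLite a b N` — "`B ⊗ ℚ_q` is a division algebra iff `q ∣ N`" for
  `B = QuaternionAlgebra ℚ a 0 b` (the finite ramification set is the set of primes of `N`);
* `Brandt.IsMaximalOrderLite S` — a subring `S ⊆ B` which is a finitely generated full
  `ℤ`-lattice, maximal among finitely generated subrings (a maximal `ℤ`-order);
* `Brandt.IsEichlerOrderLite O N⁺` — `O = O₁ ∩ O₂` with `O₁, O₂` maximal and `[O₁ : O] = N⁺`;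
* `Brandt.DefiniteSetupLite N⁺ N⁻` — the bundle: `a, b < 0` (definite), ramified exactly at
  `N⁻`, `N⁻` squarefree, an Eichler order `O` of level `N⁺`; `DefiniteSetupLite.clause` is the
  inline conjunct of the routes and `DefiniteSetupLite.ofClause` rebuilds the bundle from it;
* `Brandt.rightIdealsLite O` — full finitely generated lattices `J` with right order exactly `O`
  and an inverse `J'` (`J J' = O_L(J)`, `J' J = O`): the inline set `RI`;
* `Brandt.heckeNeighboursLite O q I` — `{J ≤ I : [I : J] = q², J O ⊆ J}`, the index set of the
  Hecke correspondence `T_q` in the inline eigen-equations;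
* `Brandt.IsGrossPointLite O ψ I` — Gross points of conductor `1` (`I ∈ rightIdealsLite O`,
  `ψ(K) ∩ O_L(I) = ψ(𝓞_K)`): the inline predicate `HG`; `Brandt.grossTranslateLite ψ 𝔞 I = ψ(𝔞) I`,
  the `Pic(𝓞_K)`-translate: the inline `L`;
* bookkeeping `let`s of the same items: `Brandt.IsCommensurablePrimeToLite O p I` (`PT`: `I` and
  `O` agree after multiplication by an integer prime to `p`), `Brandt.IsPrimitiveVecLite v w`
  (`PR`: a `v`-integral vector with a unit coordinate), `Brandt.coeffActionLite ι β P` (`ρ`: the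
  substitution action of `β ∈ Bˣ` on `F[X₀, X₁]` through `ι : B → M₂(F)`).
API: `Brandt.heckeNeighboursLite_le`, `Brandt.IsGrossPointLite.mem_rightIdealsLite`,
`Brandt.subringLattice_mem_rightIdealsLite` (the order itself, as a lattice `subringLattice O`,
is one of its right ideals — the trivial class — once it is finitely generated and full),
`DefiniteSetupLite.O_fg`, `DefiniteSetupLite.O_full`,
`DefiniteSetupLite.subringLattice_mem_rightIdealsLite`; finiteness of the Hecke correspondence
`Brandt.finite_heckeNeighboursLite` (`q ≠ 0`, `I` finitely generated: the `finsum`s over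
`heckeNeighboursLite O q I` in the route items are honest finite sums) and
`Brandt.heckeNeighboursLite_one` (`T(1)` is the identity).

Equivalence with the tree's adelic-cone notions (`Brandt.XiSetup`, `Brandt.rightIdeals`,
`Brandt.IsGrossPoint`, `Brandt.grossTranslate` of `BrandtXi.lean` / `BrandtGrossPoints.lean`) is
NOT stated here (a bridging file may do so; the routes must not import it).

Sources (locators as used for the same notions in `BrandtXi.lean` / `BrandtGrossPoints.lean`;
J. Voight, *Quaternion Algebras*, GTM 288 (2021) is not held on this hub, acq-00346):
orders and maximal orders [Voight2021, Def. 10.2.1, Def. 10.4.1]; right order, sated right ideals,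
invertibility, class set [Voight2021, Def. 16.2.9, 16.2.11, Def. 16.5.1, Def. 17.3.4]; Eichler
orders and level [Voight2021, Def. 23.4.1, 23.4.12]; Brandt matrix / `q²`-index neighbours
[Voight2021, (41.1.1)]; Gross points `(f, I)` with `f(K) ∩ O_L(I) = f(𝓞_K)` and the action of
`Pic(𝓞_K)` [Gross1987, §3]; the definite set-up `N = N⁺N⁻` [BertoliniDarmon1996, §2.1–2.3].
-/

noncomputable section

open scoped NumberField

namespace Literature.NumberTheory.Automorphic

namespace Brandt

/-! ### The definite set-up -/

section Setup

/-- **Ramified exactly at the primes of `N`**: for every prime `q`, the completed algebra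
`QuaternionAlgebra ℚ_q a 0 b` is a division algebra (every non-zero element a unit) iff `q ∣ N`
(inline clause of the routes; for squarefree `N` this says `disc B = N` up to the infinite place).
[cite: Voight2021, Def. 23.4.1] [cite: BertoliniDarmon1996, §2.1] -/
def IsRamifiedExactlyAtLite (a b : ℚ) (N : ℕ) : Prop :=
  ∀ (q : ℕ) [Fact q.Prime],
    (∀ x : QuaternionAlgebra ℚ_[q] (a : ℚ_[q]) 0 (b : ℚ_[q]), x ≠ 0 → IsUnit x) ↔ q ∣ N

variable {a b : ℚ}

/-- **Maximal `ℤ`-order, inline form**: a subring `S` of `B = QuaternionAlgebra ℚ a 0 b` whose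
additive group is finitely generated, which is full (`ℚ S = B`: every `d ∈ B` has a non-zero
integer multiple in `S`), and which is maximal among finitely generated subrings.
[cite: Voight2021, Def. 10.2.1 and Def. 10.4.1] -/
def IsMaximalOrderLite (S : Subring (QuaternionAlgebra ℚ a 0 b)) : Prop :=
  S.toAddSubgroup.FG ∧ (∀ d : QuaternionAlgebra ℚ a 0 b, ∃ n : ℤ, n ≠ 0 ∧ n • d ∈ S) ∧
    ∀ S' : Subring (QuaternionAlgebra ℚ a 0 b), S'.toAddSubgroup.FG → S ≤ S' → S' = S

/-- **Eichler order of level `N⁺`, inline form**: `O = O₁ ⊓ O₂` for maximal orders `O₁, O₂` with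
additive index `[O₁ : O] = N⁺`. [cite: Voight2021, Def. 23.4.1 and 23.4.12] -/
def IsEichlerOrderLite (O : Subring (QuaternionAlgebra ℚ a 0 b)) (Nplus : ℕ) : Prop :=
  ∃ O₁ O₂ : Subring (QuaternionAlgebra ℚ a 0 b),
    (∀ S : Subring (QuaternionAlgebra ℚ a 0 b), (S = O₁ ∨ S = O₂) → IsMaximalOrderLite S) ∧
      O = O₁ ⊓ O₂ ∧ O.toAddSubgroup.relIndex O₁.toAddSubgroup = Nplus

/-- Unfolding `IsEichlerOrderLite` to the inline clause of the routes. [folklore] -/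
theorem isEichlerOrderLite_iff (O : Subring (QuaternionAlgebra ℚ a 0 b)) (Nplus : ℕ) :
    IsEichlerOrderLite O Nplus ↔
      ∃ O₁ O₂ : Subring (QuaternionAlgebra ℚ a 0 b),
        (∀ S : Subring (QuaternionAlgebra ℚ a 0 b), (S = O₁ ∨ S = O₂) →
          (S.toAddSubgroup.FG ∧ (∀ d : QuaternionAlgebra ℚ a 0 b, ∃ n : ℤ, n ≠ 0 ∧ n • d ∈ S) ∧
            ∀ S' : Subring (QuaternionAlgebra ℚ a 0 b), S'.toAddSubgroup.FG → S ≤ S' → S' = S)) ∧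
        O = O₁ ⊓ O₂ ∧ O.toAddSubgroup.relIndex O₁.toAddSubgroup = Nplus :=
  Iff.rfl

end Setup

/-- **The definite Brandt set-up of level `N = N⁺ N⁻` (adelic-free bundle).** Rationals
`a, b < 0` (so `B = QuaternionAlgebra ℚ a 0 b` is definite), `B` ramified exactly at the primes of
the squarefree `N⁻`, and an Eichler order `O ⊆ B` of level `N⁺`.
[cite: BertoliniDarmon1996, §2.1–2.3] [cite: Voight2021, Def. 23.4.1] -/
structure DefiniteSetupLite (Nplus Nminus : ℕ) where
  /-- The first structure constant (`i² = a`). -/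
  a : ℚ
  /-- The second structure constant (`j² = b`). -/
  b : ℚ
  /-- The Eichler order. -/
  O : Subring (QuaternionAlgebra ℚ a 0 b)
  /-- `a < 0`. -/
  a_neg : a < 0
  /-- `b < 0` (with `a < 0`: `B ⊗ ℝ = ℍ`, definite). -/
  b_neg : b < 0
  /-- `B` is ramified exactly at the primes dividing `N⁻`. -/
  ramified_iff : IsRamifiedExactlyAtLite a b Nminus
  /-- `N⁻` is squarefree. -/
  squarefree : Squarefree Nminus
  /-- `O` is an Eichler order of level `N⁺`. -/
  eichler : IsEichlerOrderLite O Nplus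

namespace DefiniteSetupLite

variable {Nplus Nminus : ℕ} (S : DefiniteSetupLite Nplus Nminus)

/-- **The inline clause of the routes** (`VerticalContact`, `VerticalSelmerBound`; in
`ToricPeriodShedding` with `N⁻` replaced by `N⁻ n`): `a < 0 ∧ b < 0 ∧ (ramification) ∧
∃ O₁ O₂, …`. [folklore] -/
theorem clause :
    S.a < 0 ∧ S.b < 0 ∧
      (∀ (q : ℕ) [Fact q.Prime],
        (∀ x : QuaternionAlgebra ℚ_[q] (S.a : ℚ_[q]) 0 (S.b : ℚ_[q]), x ≠ 0 → IsUnit x) ↔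
          q ∣ Nminus) ∧
      ∃ O₁ O₂ : Subring (QuaternionAlgebra ℚ S.a 0 S.b),
        (∀ T : Subring (QuaternionAlgebra ℚ S.a 0 S.b), (T = O₁ ∨ T = O₂) →
          (T.toAddSubgroup.FG ∧
            (∀ d : QuaternionAlgebra ℚ S.a 0 S.b, ∃ n : ℤ, n ≠ 0 ∧ n • d ∈ T) ∧
            ∀ T' : Subring (QuaternionAlgebra ℚ S.a 0 S.b), T'.toAddSubgroup.FG → T ≤ T' →
              T' = T)) ∧
        S.O = O₁ ⊓ O₂ ∧ S.O.toAddSubgroup.relIndex O₁.toAddSubgroup = Nplus :=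
  ⟨S.a_neg, S.b_neg, S.ramified_iff, S.eichler⟩

/-- Rebuilding the bundle from the inline clause (plus `Squarefree N⁻`, which the routes carry in
their conductor clause). [folklore] -/
def ofClause {a b : ℚ} (O : Subring (QuaternionAlgebra ℚ a 0 b)) (hsq : Squarefree Nminus)
    (h : a < 0 ∧ b < 0 ∧
      (∀ (q : ℕ) [Fact q.Prime],
        (∀ x : QuaternionAlgebra ℚ_[q] (a : ℚ_[q]) 0 (b : ℚ_[q]), x ≠ 0 → IsUnit x) ↔ q ∣ Nminus) ∧
      ∃ O₁ O₂ : Subring (QuaternionAlgebra ℚ a 0 b),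
        (∀ T : Subring (QuaternionAlgebra ℚ a 0 b), (T = O₁ ∨ T = O₂) →
          (T.toAddSubgroup.FG ∧ (∀ d : QuaternionAlgebra ℚ a 0 b, ∃ n : ℤ, n ≠ 0 ∧ n • d ∈ T) ∧
            ∀ T' : Subring (QuaternionAlgebra ℚ a 0 b), T'.toAddSubgroup.FG → T ≤ T' → T' = T)) ∧
        O = O₁ ⊓ O₂ ∧ O.toAddSubgroup.relIndex O₁.toAddSubgroup = Nplus) :
    DefiniteSetupLite Nplus Nminus where
  a := a
  b := b
  O := O
  a_neg := h.1
  b_neg := h.2.1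
  ramified_iff := h.2.2.1
  squarefree := hsq
  eichler := h.2.2.2

/-- A subgroup of a finitely generated additive subgroup of `B` is finitely generated (`ℤ` is
Noetherian). [folklore] -/
theorem _root_.Literature.NumberTheory.Automorphic.Brandt.addSubgroup_fg_of_le
    {M : Type*} [AddCommGroup M] {S T : AddSubgroup M} (hT : T.FG) (hST : S ≤ T) : S.FG := by
  have hT' : (AddSubgroup.toIntSubmodule T).FG := by
    rw [Submodule.fg_iff_addSubgroup_fg, AddSubgroup.toIntSubmodule_toAddSubgroup]
    exact hT
  have hle : AddSubgroup.toIntSubmodule S ≤ AddSubgroup.toIntSubmodule T :=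
    (AddSubgroup.toIntSubmodule (M := M)).monotone hST
  have hS := Submodule.FG.of_le hT' hle
  rw [Submodule.fg_iff_addSubgroup_fg, AddSubgroup.toIntSubmodule_toAddSubgroup] at hS
  exact hS

/-- The order of the set-up is finitely generated as an additive group (it sits in the finitely
generated `O₁`). [folklore] -/
theorem O_fg : S.O.toAddSubgroup.FG := by
  obtain ⟨O₁, O₂, hmax, hO, -⟩ := S.eichler
  have h₁ : O₁.toAddSubgroup.FG := (hmax O₁ (Or.inl rfl)).1
  have hle : S.O.toAddSubgroup ≤ O₁.toAddSubgroup := by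
    intro x hx
    have hx' : x ∈ S.O := hx
    rw [hO] at hx'
    exact hx'.1
  exact addSubgroup_fg_of_le h₁ hle

/-- The order of the set-up is a full lattice: every `d ∈ B` has a non-zero integer multiple in
`O` (multiply the denominators for `O₁` and `O₂`). [folklore] -/
theorem O_full (d : QuaternionAlgebra ℚ S.a 0 S.b) : ∃ n : ℤ, n ≠ 0 ∧ n • d ∈ S.O := by
  obtain ⟨O₁, O₂, hmax, hO, -⟩ := S.eichler
  obtain ⟨n₁, hn₁, h₁⟩ := (hmax O₁ (Or.inl rfl)).2.1 d
  obtain ⟨n₂, hn₂, h₂⟩ := (hmax O₂ (Or.inr rfl)).2.1 d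
  refine ⟨n₂ * n₁, mul_ne_zero hn₂ hn₁, ?_⟩
  rw [hO]
  refine ⟨?_, ?_⟩
  · rw [mul_smul]
    exact O₁.toAddSubgroup.zsmul_mem h₁ n₂
  · rw [mul_comm, mul_smul]
    exact O₂.toAddSubgroup.zsmul_mem h₂ n₁

end DefiniteSetupLite

/-! ### Right ideals, Hecke neighbours, Gross points (inline forms) -/

section Ideals

variable {a b : ℚ}

/-- **Invertible right `O`-ideals, inline form** (the set `RI` of the routes): finitely generated
full lattices `J ⊆ B` whose right order `{x : J x ⊆ J}` is exactly `O` and which admit an inverse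
`J'` with `J J' = O_L(J)` and `J' J = O`. Their classes under `J ↦ β J`, `β ∈ Bˣ`, form the class
set `Cls O`. [cite: Voight2021, Def. 16.2.9, 16.2.11, Def. 16.5.1 and Def. 17.3.4] -/
def rightIdealsLite (O : Subring (QuaternionAlgebra ℚ a 0 b)) :
    Set (Submodule ℤ (QuaternionAlgebra ℚ a 0 b)) :=
  {J | J.FG ∧ (∀ d : QuaternionAlgebra ℚ a 0 b, ∃ n : ℤ, n ≠ 0 ∧ n • d ∈ J) ∧
    (∀ x : QuaternionAlgebra ℚ a 0 b, (∀ y ∈ J, y * x ∈ J) ↔ x ∈ O) ∧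
    ∃ J' : Submodule ℤ (QuaternionAlgebra ℚ a 0 b),
      (∀ x : QuaternionAlgebra ℚ a 0 b, x ∈ J * J' ↔ ∀ y ∈ J, x * y ∈ J) ∧
      (∀ x : QuaternionAlgebra ℚ a 0 b, x ∈ J' * J ↔ x ∈ O)}

/-- Unfolding `rightIdealsLite` to the inline clause (`J ∈ RI ↔ …` of `ToricPeriodShedding`). [folklore] -/
theorem mem_rightIdealsLite_iff (O : Subring (QuaternionAlgebra ℚ a 0 b))
    (J : Submodule ℤ (QuaternionAlgebra ℚ a 0 b)) :
    J ∈ rightIdealsLite O ↔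
      J.FG ∧ (∀ d : QuaternionAlgebra ℚ a 0 b, ∃ n : ℤ, n ≠ 0 ∧ n • d ∈ J) ∧
        (∀ x : QuaternionAlgebra ℚ a 0 b, (∀ y ∈ J, y * x ∈ J) ↔ x ∈ O) ∧
        ∃ J' : Submodule ℤ (QuaternionAlgebra ℚ a 0 b),
          (∀ x : QuaternionAlgebra ℚ a 0 b, x ∈ J * J' ↔ ∀ y ∈ J, x * y ∈ J) ∧
          (∀ x : QuaternionAlgebra ℚ a 0 b, x ∈ J' * J ↔ x ∈ O) :=
  Iff.rfl

/-- **Hecke neighbours, inline form**: the right-`O`-stable sublattices `J ⊆ I` of index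
`[I : J] = q²` — the index set of the Hecke correspondence `T_q` (`q`-th Brandt matrix) in the
eigen-equations `Σ_{J} Φ(J) = λ_q Φ(I)` of the routes. [cite: Voight2021, (41.1.1)] -/
def heckeNeighboursLite (O : Subring (QuaternionAlgebra ℚ a 0 b)) (q : ℕ)
    (I : Submodule ℤ (QuaternionAlgebra ℚ a 0 b)) : Set (Submodule ℤ (QuaternionAlgebra ℚ a 0 b)) :=
  {J | J ≤ I ∧ J.toAddSubgroup.relIndex I.toAddSubgroup = q ^ 2 ∧ ∀ y ∈ J, ∀ x ∈ O, y * x ∈ J}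

/-- Unfolding `heckeNeighboursLite` to the inline index set of the routes. [folklore] -/
theorem mem_heckeNeighboursLite_iff (O : Subring (QuaternionAlgebra ℚ a 0 b)) (q : ℕ)
    (I J : Submodule ℤ (QuaternionAlgebra ℚ a 0 b)) :
    J ∈ heckeNeighboursLite O q I ↔
      J ≤ I ∧ J.toAddSubgroup.relIndex I.toAddSubgroup = q ^ 2 ∧ ∀ y ∈ J, ∀ x ∈ O, y * x ∈ J :=
  Iff.rfl

/-- A Hecke neighbour of `I` is a sublattice of `I`. [folklore] -/
theorem heckeNeighboursLite_le {O : Subring (QuaternionAlgebra ℚ a 0 b)} {q : ℕ}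
    {I J : Submodule ℤ (QuaternionAlgebra ℚ a 0 b)} (h : J ∈ heckeNeighboursLite O q I) : J ≤ I :=
  h.1

/-- **`I` agrees with `O` away from `p`, inline form** (`PT` of the routes): some integer `n₀`
prime to `p` multiplies `O` into `I` and `I` into `O`. [folklore] -/
def IsCommensurablePrimeToLite (O : Subring (QuaternionAlgebra ℚ a 0 b)) (p : ℕ)
    (I : Submodule ℤ (QuaternionAlgebra ℚ a 0 b)) : Prop :=
  ∃ n₀ : ℕ, n₀.Coprime p ∧ (∀ x ∈ O, (n₀ : ℤ) • x ∈ I) ∧ ∀ x ∈ I, (n₀ : ℤ) • x ∈ O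

/-- Unfolding `IsCommensurablePrimeToLite`. [folklore] -/
theorem isCommensurablePrimeToLite_iff (O : Subring (QuaternionAlgebra ℚ a 0 b)) (p : ℕ)
    (I : Submodule ℤ (QuaternionAlgebra ℚ a 0 b)) :
    IsCommensurablePrimeToLite O p I ↔
      ∃ n₀ : ℕ, n₀.Coprime p ∧ (∀ x ∈ O, (n₀ : ℤ) • x ∈ I) ∧ ∀ x ∈ I, (n₀ : ℤ) • x ∈ O :=
  Iff.rfl

variable {K : Type*} [Field K] [NumberField K]

/-- **Gross point of conductor `1`, inline form** (`HG` of the routes): a right ideal `I` of `O`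
and an embedding `ψ : K → B` that is OPTIMAL for the pair, `ψ(K) ∩ O_L(I) = ψ(𝓞_K)` — written as:
`ψ(𝓞_K)` stabilises `I` from the left, and every `x ∈ K` with `ψ(x) I ⊆ I` is integral.
(Gross 1987 §3, pairs `(f, R_i)` / `(f, I)` with `f(K) ∩ R = f(𝓞)`; left and right exchanged as in
all Brandt files of the tree.) [cite: Gross1987, §3] -/
def IsGrossPointLite (O : Subring (QuaternionAlgebra ℚ a 0 b)) (ψ : K →ₐ[ℚ] QuaternionAlgebra ℚ a 0 b)
    (I : Submodule ℤ (QuaternionAlgebra ℚ a 0 b)) : Prop :=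
  I ∈ rightIdealsLite O ∧ (∀ x : 𝓞 K, ∀ y ∈ I, ψ (x : K) * y ∈ I) ∧
    ∀ x : K, (∀ y ∈ I, ψ x * y ∈ I) → ∃ z : 𝓞 K, (z : K) = x

/-- Unfolding `IsGrossPointLite` to the inline predicate `HG`. [folklore] -/
theorem isGrossPointLite_iff (O : Subring (QuaternionAlgebra ℚ a 0 b))
    (ψ : K →ₐ[ℚ] QuaternionAlgebra ℚ a 0 b) (I : Submodule ℤ (QuaternionAlgebra ℚ a 0 b)) :
    IsGrossPointLite O ψ I ↔
      I ∈ rightIdealsLite O ∧ (∀ x : 𝓞 K, ∀ y ∈ I, ψ (x : K) * y ∈ I) ∧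
        ∀ x : K, (∀ y ∈ I, ψ x * y ∈ I) → ∃ z : 𝓞 K, (z : K) = x :=
  Iff.rfl

/-- A Gross point's lattice is one of the right ideals. [folklore] -/
theorem IsGrossPointLite.mem_rightIdealsLite {O : Subring (QuaternionAlgebra ℚ a 0 b)}
    {ψ : K →ₐ[ℚ] QuaternionAlgebra ℚ a 0 b} {I : Submodule ℤ (QuaternionAlgebra ℚ a 0 b)}
    (h : IsGrossPointLite O ψ I) : I ∈ rightIdealsLite O :=
  h.1

/-- **Gross's translate `ψ(𝔞) I`, inline form** (`L` of the routes, for `𝔞` a representative of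
an ideal class): the `ℤ`-span of `ψ(𝔞)` times `I` — the action of the ideal group of `K`
(descending to `Pic(𝓞_K)`) on pairs `(ψ, I)`. [cite: Gross1987, §3] -/
def grossTranslateLite (ψ : K →ₐ[ℚ] QuaternionAlgebra ℚ a 0 b) (𝔞 : Ideal (𝓞 K))
    (I : Submodule ℤ (QuaternionAlgebra ℚ a 0 b)) : Submodule ℤ (QuaternionAlgebra ℚ a 0 b) :=
  Submodule.span ℤ ((fun x : 𝓞 K => ψ (x : K)) '' (𝔞 : Set (𝓞 K))) * I

/-- Unfolding `grossTranslateLite` to the inline lattice of the routes. [folklore] -/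
theorem grossTranslateLite_def (ψ : K →ₐ[ℚ] QuaternionAlgebra ℚ a 0 b) (𝔞 : Ideal (𝓞 K))
    (I : Submodule ℤ (QuaternionAlgebra ℚ a 0 b)) :
    grossTranslateLite ψ 𝔞 I = Submodule.span ℤ ((fun x : 𝓞 K => ψ (x : K)) '' (𝔞 : Set (𝓞 K))) * I :=
  rfl

end Ideals

/-! ### Bookkeeping `let`s of the route items -/

section Bookkeeping

/-- **Primitive vector, inline form** (`PR` of the routes): `w : Fin 2 → F` is `v`-integral with
some coordinate a `v`-unit. [folklore] -/
def IsPrimitiveVecLite {F Γ₀ : Type*} [Ring F] [LinearOrderedCommMonoidWithZero Γ₀]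
    (v : Valuation F Γ₀) (w : Fin 2 → F) : Prop :=
  (∀ i, v (w i) ≤ 1) ∧ ∃ i, v (w i) = 1

/-- Unfolding `IsPrimitiveVecLite`. [folklore] -/
theorem isPrimitiveVecLite_iff {F Γ₀ : Type*} [Ring F] [LinearOrderedCommMonoidWithZero Γ₀]
    (v : Valuation F Γ₀) (w : Fin 2 → F) :
    IsPrimitiveVecLite v w ↔ (∀ i, v (w i) ≤ 1) ∧ ∃ i, v (w i) = 1 :=
  Iff.rfl

/-- **The substitution action of `Bˣ` on binary forms, inline form** (`ρ` of the routes): through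
`ι : B → M₂(F)`, `β` acts on `P ∈ F[X₀, X₁]` by `X_j ↦ Σ_i X_i ι(β)_{ij}`. [folklore] -/
def coeffActionLite {B F : Type*} [Ring B] [Field F] [Algebra ℚ B] [Algebra ℚ F]
    (ι : B →ₐ[ℚ] Matrix (Fin 2) (Fin 2) F) (β : Bˣ) (P : MvPolynomial (Fin 2) F) :
    MvPolynomial (Fin 2) F :=
  MvPolynomial.aeval
    (fun j : Fin 2 => ∑ i : Fin 2, MvPolynomial.X (R := F) i * MvPolynomial.C (ι β.1 i j)) P

/-- Unfolding `coeffActionLite`. [folklore] -/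
theorem coeffActionLite_def {B F : Type*} [Ring B] [Field F] [Algebra ℚ B] [Algebra ℚ F]
    (ι : B →ₐ[ℚ] Matrix (Fin 2) (Fin 2) F) (β : Bˣ) (P : MvPolynomial (Fin 2) F) :
    coeffActionLite ι β P =
      MvPolynomial.aeval
        (fun j : Fin 2 => ∑ i : Fin 2, MvPolynomial.X (R := F) i * MvPolynomial.C (ι β.1 i j)) P :=
  rfl

end Bookkeeping

/-! ### The order is one of its own right ideals -/

section Trivial

variable {a b : ℚ}

/-- The `ℤ`-lattice underlying a subring `O ⊆ B` (its additive group as a `ℤ`-submodule).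
[folklore] -/
def subringLattice (O : Subring (QuaternionAlgebra ℚ a 0 b)) :
    Submodule ℤ (QuaternionAlgebra ℚ a 0 b) :=
  AddSubgroup.toIntSubmodule O.toAddSubgroup

/-- Membership in `subringLattice O` is membership in `O`. [folklore] -/
@[simp]
theorem mem_subringLattice {O : Subring (QuaternionAlgebra ℚ a 0 b)} {x : QuaternionAlgebra ℚ a 0 b} :
    x ∈ subringLattice O ↔ x ∈ O := by
  rw [subringLattice, ← SetLike.mem_coe, AddSubgroup.coe_toIntSubmodule]
  rfl

/-- `O O = O` for the lattice of a subring. [folklore] -/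
theorem subringLattice_mul_self (O : Subring (QuaternionAlgebra ℚ a 0 b)) :
    subringLattice O * subringLattice O = subringLattice O := by
  refine le_antisymm (Submodule.mul_le.mpr fun m hm n hn => ?_) fun x hx => ?_
  · rw [mem_subringLattice] at hm hn ⊢
    exact O.mul_mem hm hn
  · have h1 : (1 : QuaternionAlgebra ℚ a 0 b) ∈ subringLattice O := mem_subringLattice.mpr O.one_mem
    simpa using Submodule.mul_mem_mul hx h1

/-- **The trivial class**: a subring `O ⊆ B` which is finitely generated and full is, as a
`ℤ`-lattice, one of its invertible right ideals (right order `O` since `1 ∈ O`; inverse `O`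
itself, `O O = O`). [cite: Voight2021, Def. 16.5.1 and Def. 17.3.4] -/
theorem subringLattice_mem_rightIdealsLite (O : Subring (QuaternionAlgebra ℚ a 0 b))
    (hfg : O.toAddSubgroup.FG) (hfull : ∀ d : QuaternionAlgebra ℚ a 0 b, ∃ n : ℤ, n ≠ 0 ∧ n • d ∈ O) :
    subringLattice O ∈ rightIdealsLite O := by
  have hone : (1 : QuaternionAlgebra ℚ a 0 b) ∈ subringLattice O := mem_subringLattice.mpr O.one_mem
  refine ⟨?_, ?_, ?_, subringLattice O, ?_, ?_⟩
  · rw [Submodule.fg_iff_addSubgroup_fg, subringLattice, AddSubgroup.toIntSubmodule_toAddSubgroup]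
    exact hfg
  · intro d
    obtain ⟨n, hn, h⟩ := hfull d
    exact ⟨n, hn, mem_subringLattice.mpr h⟩
  · intro x
    constructor
    · intro h
      simpa using h 1 hone
    · intro hx y hy
      rw [mem_subringLattice] at hy ⊢
      exact O.mul_mem hy hx
  · intro x
    rw [subringLattice_mul_self]
    constructor
    · intro hx y hy
      rw [mem_subringLattice] at hx hy ⊢
      exact O.mul_mem hx hy
    · intro h
      simpa using h 1 hone
  · intro x
    rw [subringLattice_mul_self, mem_subringLattice]

/-- The Eichler order of a definite set-up is one of its own right ideals (the trivial class of
`Cls O`). [cite: Voight2021, Def. 17.3.4] -/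
theorem DefiniteSetupLite.subringLattice_mem_rightIdealsLite {Nplus Nminus : ℕ}
    (S : DefiniteSetupLite Nplus Nminus) : subringLattice S.O ∈ rightIdealsLite S.O :=
  Brandt.subringLattice_mem_rightIdealsLite S.O S.O_fg S.O_full

end Trivial

/-! ### Finiteness of the Hecke correspondence

The eigen-equations of the route items sum `Φ` over `heckeNeighboursLite O q I` with `finsum`,
whose value is the junk `0` on an infinite support.  The support is finite: a sublattice `J ⊆ I` of
finite index `[I : J] = q²` contains `q² I`, and the window `q² I ⊆ J ⊆ I` is finite because
`I / q² I` is (`I` finitely generated and torsion-free, hence free of finite rank).  This is the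
finiteness of the Brandt-matrix count `T(q)_{ij}` (Voight (41.1.1); Pizer 1980 §2); `T(1)` is the
identity (`heckeNeighboursLite_one`). -/

section Finiteness

variable {a b : ℚ}

/-- **Window finiteness**: for a finitely generated lattice `I ⊆ B` and an integer `n ≠ 0` there
are only finitely many sublattices `J ⊆ I` containing `n I` (they correspond to subgroups of the
finite group `I / n I`; `B` is torsion-free as a `ℚ`-vector space). [folklore] -/
theorem finite_setOf_le_and_smul_mem_lite (I : Submodule ℤ (QuaternionAlgebra ℚ a 0 b))
    (hI : I.FG) {n : ℤ} (hn : n ≠ 0) :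
    {J : Submodule ℤ (QuaternionAlgebra ℚ a 0 b) | J ≤ I ∧ ∀ x ∈ I, n • x ∈ J}.Finite := by
  classical
  haveI : IsAddTorsionFree (QuaternionAlgebra ℚ a 0 b) := IsAddTorsionFree.of_module_rat _
  haveI : Module.Finite ℤ I := Module.Finite.iff_fg.mpr hI
  let f : I →ₗ[ℤ] I := DistribSMul.toLinearMap ℤ I n
  have hf : Function.Injective f := fun x y hxy =>
    smul_right_injective I hn (by simpa [f] using hxy)
  let W : Submodule ℤ I := LinearMap.range f
  haveI hQ : Finite (I ⧸ W) := by
    refine Submodule.finiteQuotientOfFreeOfRankEq W ?_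
    exact (LinearEquiv.ofInjective f hf).finrank_eq.symm
  let g : Submodule ℤ (QuaternionAlgebra ℚ a 0 b) → Set (I ⧸ W) := fun P =>
    W.mkQ '' (P.comap I.subtype : Set I)
  refine Set.Finite.of_finite_image (Set.toFinite _) (f := g) fun P hP P' hP' hPP' => ?_
  have key : ∀ Q : Submodule ℤ (QuaternionAlgebra ℚ a 0 b), Q ≤ I → (∀ x ∈ I, n • x ∈ Q) →
      Subtype.val '' (W.mkQ ⁻¹' (g Q)) = (Q : Set (QuaternionAlgebra ℚ a 0 b)) := by
    intro Q hQI hQn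
    have hsat : W.mkQ ⁻¹' (g Q) = (Q.comap I.subtype : Set I) := by
      ext x
      constructor
      · rintro ⟨y, hy, hyx⟩
        have hxy : x - y ∈ W := by
          rw [← Submodule.Quotient.eq]
          exact hyx.symm
        obtain ⟨z, hz⟩ := hxy
        have : x = f z + y := by rw [hz, sub_add_cancel]
        rw [this]
        exact add_mem (hQn z z.2) hy
      · intro hx
        exact ⟨x, hx, rfl⟩
    rw [hsat]
    ext d
    constructor
    · rintro ⟨x, hx, rfl⟩
      exact hx
    · intro hd
      exact ⟨⟨d, hQI hd⟩, hd, rfl⟩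
  have := key P hP.1 hP.2
  rw [hPP', key P' hP'.1 hP'.2] at this
  exact SetLike.coe_injective this.symm

/-- **The Hecke correspondence is finite**: for `q ≠ 0` and a finitely generated lattice `I`, the
set `heckeNeighboursLite O q I` of right-`O`-stable sublattices of index `q²` is finite (each
contains `q² I`, by Lagrange in the finite group `I / J`), so the `finsum`s over it in the route
items are honest finite sums — the finiteness of the Brandt-matrix entries `T(q)_{ij}`.
[cite: Voight2021, (41.1.1)] -/
theorem finite_heckeNeighboursLite (O : Subring (QuaternionAlgebra ℚ a 0 b)) {q : ℕ} (hq : q ≠ 0)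
    {I : Submodule ℤ (QuaternionAlgebra ℚ a 0 b)} (hI : I.FG) :
    (heckeNeighboursLite O q I).Finite := by
  refine (finite_setOf_le_and_smul_mem_lite I hI (n := ((q ^ 2 : ℕ) : ℤ))
    (by exact_mod_cast pow_ne_zero 2 hq)).subset ?_
  rintro J ⟨hJI, hidx, -⟩
  refine ⟨hJI, fun x hx => ?_⟩
  have h := AddSubgroup.nsmul_index_mem (J.toAddSubgroup.addSubgroupOf I.toAddSubgroup) ⟨x, hx⟩
  rw [AddSubgroup.mem_addSubgroupOf] at h
  rw [AddSubgroup.relIndex] at hidx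
  rw [hidx] at h
  rw [natCast_zsmul]
  exact h

/-- The Hecke correspondence at a right ideal `I ∈ rightIdealsLite O` is finite for `q ≠ 0`
(right ideals are finitely generated). [cite: Voight2021, (41.1.1)] -/
theorem finite_heckeNeighboursLite_of_mem {O : Subring (QuaternionAlgebra ℚ a 0 b)} {q : ℕ}
    (hq : q ≠ 0) {I : Submodule ℤ (QuaternionAlgebra ℚ a 0 b)} (hI : I ∈ rightIdealsLite O) :
    (heckeNeighboursLite O q I).Finite :=
  finite_heckeNeighboursLite O hq hI.1

/-- A right ideal `I ∈ rightIdealsLite O` is right-`O`-stable: `I O ⊆ I` (its right order is `O`).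
[folklore] -/
theorem mul_mem_of_mem_rightIdealsLite {O : Subring (QuaternionAlgebra ℚ a 0 b)}
    {I : Submodule ℤ (QuaternionAlgebra ℚ a 0 b)} (hI : I ∈ rightIdealsLite O)
    {y : QuaternionAlgebra ℚ a 0 b} (hy : y ∈ I) {x : QuaternionAlgebra ℚ a 0 b} (hx : x ∈ O) :
    y * x ∈ I :=
  (hI.2.2.1 x).mpr hx y hy

/-- **`T(1)` is the identity**: the only right-`O`-stable sublattice of `I` of index `1` is `I`
itself (for `I` right-`O`-stable, e.g. `I ∈ rightIdealsLite O`). [cite: Voight2021, (41.1.1)] -/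
theorem heckeNeighboursLite_one (O : Subring (QuaternionAlgebra ℚ a 0 b))
    {I : Submodule ℤ (QuaternionAlgebra ℚ a 0 b)} (hI : ∀ y ∈ I, ∀ x ∈ O, y * x ∈ I) :
    heckeNeighboursLite O 1 I = {I} := by
  ext J
  rw [mem_heckeNeighboursLite_iff, Set.mem_singleton_iff, one_pow, AddSubgroup.relIndex_eq_one]
  constructor
  · rintro ⟨hJI, hIJ, -⟩
    exact le_antisymm hJI fun x hx => hIJ hx
  · rintro rfl
    exact ⟨le_rfl, le_rfl, hI⟩

/-- `T(1)` is the identity on the right ideals of `O`. [cite: Voight2021, (41.1.1)] -/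
theorem heckeNeighboursLite_one_of_mem {O : Subring (QuaternionAlgebra ℚ a 0 b)}
    {I : Submodule ℤ (QuaternionAlgebra ℚ a 0 b)} (hI : I ∈ rightIdealsLite O) :
    heckeNeighboursLite O 1 I = {I} :=
  heckeNeighboursLite_one O fun _ hy _ hx => mul_mem_of_mem_rightIdealsLite hI hy hx

end Finiteness

end Brandt

end Literature.NumberTheory.Automorphic

end
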